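import Mathlib
import Summits.QuantumFields.BalabanUV.Beta.AveragedBondUnrolling
import Summits.QuantumFields.BalabanUV.Beta.CovariantPlateauBlocksPair

/-!
# Beta / AveragedContourChain — B9 (3.55)'s RECURSIVE CONTOUR VARIABLES WITH AVERAGED LEGS as TERMS over b07, their
# unrolled fine polygon, and the j-UNIFORM comparison: `‖U(Γ^{(j)}_{y,x}) − U(fine polygon)‖ ≤ Σ_{l<j} |r_l|₁·E_l`; END = the
# mixed-loop defect of PRINT's transport against the straight tree transport from the per-plaquette input alone (d4-p2's
# area law (P) BY NAME) — part 2 of 2 of the «averaged legs» input of E-I3 (row-D4 owner's NOTE-I3 v1.2.2 §6.6; item O.2 (iv))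
# (unit `b2b-balaban-beta-an4`, row D4 OWNER, GEN 41; journal ONLINE l.16433, part 1 = `AveragedBondUnrolling` p225113)

HONEST FRAMING: discharging `BetaPertH` makes Bałaban's UV stability UNCONDITIONAL — NOT the continuum limit, NOT the
Clay problem.  HONEST DEPENDENCY (verbatim): «continuum YM on T⁴ ⇐ BetaPertH ∧ nine spine estimates (0/9 proved);
BetaPertH ⇐ (D1) ∧ (D4) ∧ CAP+tail; G-an2-4 gates asym, D1 and NE2/3/4.»  THIS MODULE DISCHARGES NOTHING of `BetaPertH`,
asserts NOTHING printed and cites nothing as a fact (ABSOLUTE RULE): [folklore] bookkeeping on `ℤ^d` over the b07 lineage's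
CERTIFIED terms for [B7] = `Balaban1985Averaging` ((42)–(43), Props. 1–2: `bavg`, `avgIter`, `prop2_explicit` BY NAME) and
d4-p2's area law for monotone loops (`MonotoneLoopHolonomy.norm_hol_posWord_perm_le`, p223523) and positive-list kit
(`CovariantPlateauBlocksPair.treeList`, p223754) BY NAME.  READING (a locator-level identification, recorded as such; d4-p3
C-d4p3-19 INFO-1 concurs): [B9] = `Balaban1985BackgroundPropagators` (3.19) p. 393 / (3.55) p. 401 «(U′U)(Γ^{(j)}_{y,x}) =
\overline{(U′U)}^{j−1}(Γ_{y,x_{j−1}})·…·\overline{(U′U)}(Γ_{x₂,x₁})(U′U)(Γ_{x₁,x}) … the sequence of points y = x_j, x_{j−1}, …,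
x₁, x = x₀ is defined by the conditions x_l ∈ B(x_{l+1})» with B7's base-point blocks (B5 (1.6), b07 `boxVec`): `x_l` = the
level-`l` site `⌊x∕L^l⌋` (`qv`), the leg `Γ_{x_{l+1},x_l}` = b07's tree contour of the offset `r_l = x_l − L·x_{l+1} ∈ [0,L)^d`
on the `l`-lattice, carried by the AVERAGED field `Ū^l = avgIter L U l`.  The plaquette bound on `U` is a HYPOTHESIS (print:
(3.35) ⟹ it, kernel `B9Eq335Plaquette.b7_52_of_b9_335`); nothing of B9's propagators is bounded.  No class change on row D4
or G-B9-15 (width 0; D4 DISCHARGE NO DATE); NOT BetaPertH, NOT continuum, NOT Clay, NOT summit progress.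

CONTENT (kernel, 0 sorry).  §1 nested sites `qv L l v = ⌊v∕L^l⌋`, leg offsets `rv ∈ [0, L)^d` (`l1_rv_le ≤ d(L−1)`).  §2 **`leg`**,
**`chain`** (the (3.55) product, top level first), the unrolled fine polygon **`fineList`** (POSITIVE; `disp = v − L^j•qv j`).
§3 **`norm_chain_sub_fine_le`** (`≤ Σ_{l<j} |r_l|₁·E_l` from part 1's level defects).  §4 END **`norm_tree_mul_chain_inv_sub_one_le`**
(`‖U(treeWord v)·chain⁻¹ − 1‖ ≤ C(|v|₁, 2)·α + Σ_{l<j} |r_l|₁·E_l`: d4-p2's area law for the monotone pair + §3).  §5 the level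
defects FROM THE FINE PLAQUETTES ALONE via b07's Prop. 2 (**`level_inputs_of_prop2`**), the assembled END **`print_transport_defect`**
and its CLOSED FORM **`print_transport_defect_closed`** (`≤ C(|v|₁,2)·α + 64d(d+1)²·αL^{2j}∕(L+1)` — `O(d³·Mα₀)` UNIFORMLY IN `j` once
`αL^{2j} = O(Mα₀)`).  §6 non-vacuity (flat field).
-/

namespace Summit.QuantumFields.BalabanUV.Beta.AveragedContourChain

open scoped BigOperators
open Finset
open Literature.MathematicalPhysics.QuantumFieldTheory.Balaban1983to89 B7Prop1Explicit B7Prop2Explicit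
open Summit.QuantumFields.BalabanUV.Beta.MonotoneLoopHolonomy
open Summit.QuantumFields.BalabanUV.Beta.CovariantPlateauBlocksPair (treeList posWord_treeList disp_posWord_treeList
  length_treeList perm_of_disp_eq)
open Summit.QuantumFields.BalabanUV.Beta.AveragedBondUnrolling
open Summit.QuantumFields.BalabanUV.T4Continuum.GaugeFieldPerturbation (norm_mul_sub_mul_le_of_norm_le_one)

variable {d : ℕ}

/-! ## §1 Nested sites and leg offsets (corner blocks) -/

/-- A natural offset vector as a site of `ℤ^d`. [folklore] -/
def natVec (v : Fin d → ℕ) : Site d := fun i => ((v i : ℕ) : ℤ)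
/-- `natVec v ≥ 0`. [folklore] -/
theorem natVec_nonneg (v : Fin d → ℕ) (i : Fin d) : 0 ≤ natVec v i := Int.natCast_nonneg _

/-- The level-`l` site containing the fine site `v` (base-point blocks): `x_l = ⌊v∕L^l⌋` componentwise, in level-`l`
coordinates. [cite: Balaban1985BackgroundPropagators, (3.55) p.401] -/
def qv (L l : ℕ) (v : Fin d → ℕ) : Site d := fun i => ((v i / L ^ l : ℕ) : ℤ)

/-- `x_0 = v`. [folklore] -/
@[simp] theorem qv_zero (L : ℕ) (v : Fin d → ℕ) : qv L 0 v = natVec v := by funext i; simp [qv, natVec]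

/-- The offset of the leg at level `l`: `r_l = x_l − L·x_{l+1}` (the position of `x_l` inside the `L`-block of the
`l`-lattice with base point `x_{l+1}`). [cite: Balaban1985BackgroundPropagators, (3.55) p.401] -/
def rv (L l : ℕ) (v : Fin d → ℕ) : Site d := qv L l v - (L : ℤ) • qv L (l + 1) v

/-- `r_l ≥ 0` (`L·⌊a∕L⌋ ≤ a` with `a = ⌊v∕L^l⌋`, `⌊a∕L⌋ = ⌊v∕L^{l+1}⌋`). [folklore] -/
theorem rv_nonneg (L l : ℕ) (v : Fin d → ℕ) (i : Fin d) : 0 ≤ rv L l v i := by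
  simp only [rv, qv, Pi.sub_apply, Pi.smul_apply, smul_eq_mul, sub_nonneg]
  rw [show v i / L ^ (l + 1) = v i / L ^ l / L by rw [Nat.div_div_eq_div_mul, pow_succ]]
  exact_mod_cast Nat.mul_div_le (v i / L ^ l) L

/-- `r_l < L` (`a − L·⌊a∕L⌋ = a mod L`). [folklore] -/
theorem rv_lt (L l : ℕ) (hL : 0 < L) (v : Fin d → ℕ) (i : Fin d) : rv L l v i < L := by
  simp only [rv, qv, Pi.sub_apply, Pi.smul_apply, smul_eq_mul]
  rw [show v i / L ^ (l + 1) = v i / L ^ l / L by rw [Nat.div_div_eq_div_mul, pow_succ]]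
  have h3 : (((v i / L ^ l : ℕ)) : ℤ) = (((v i / L ^ l) % L : ℕ) : ℤ) + (L : ℤ) * (((v i / L ^ l) / L : ℕ) : ℤ) := by
    exact_mod_cast (Nat.mod_add_div (v i / L ^ l) L).symm
  have h4 : (((v i / L ^ l) % L : ℕ) : ℤ) < (L : ℤ) := by exact_mod_cast Nat.mod_lt (v i / L ^ l) hL
  linarith

/-- `|r_l|₁ ≤ d(L − 1)`. [folklore] -/
theorem l1_rv_le (L l : ℕ) (hL : 0 < L) (v : Fin d → ℕ) : l1 (rv L l v) ≤ d * (L - 1) := by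
  unfold l1
  calc ∑ i, (rv L l v i).natAbs ≤ ∑ _i : Fin d, (L - 1) := Finset.sum_le_sum fun i _ => by
          have h0 := rv_nonneg L l v i
          have h1 := rv_lt L l hL v i
          omega
    _ = d * (L - 1) := by rw [Finset.sum_const, Finset.card_univ, Fintype.card_fin, smul_eq_mul]

/-- Inside the `j`-block with base point `0` the top site is the base point: `v < L^j ⟹ x_j = 0`. [folklore] -/
theorem qv_eq_zero_of_lt (L j : ℕ) (v : Fin d → ℕ) (hv : ∀ i, v i < L ^ j) : qv L j v = 0 := by
  funext i; simp [qv, Nat.div_eq_of_lt (hv i)]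

/-! ## §2 The (3.55) chain with AVERAGED legs, and its unrolled fine polygon -/

section Chain

variable {𝔸 : Type*} [NormedRing 𝔸] [NormOneClass 𝔸] [NormedAlgebra ℂ 𝔸] [CompleteSpace 𝔸]
variable (L : ℕ) (V : Site d → Fin d → 𝔸ˣ)

/-- **THE LEG AT LEVEL `l`**: the transport of the AVERAGED configuration `Ū^l = avgIter L U l` along b07's tree contour from
the base point `L·x_{l+1}` (read on the `l`-lattice) to `x_l` — `\overline{U}^{l}(Γ_{x_{l+1},x_l})` of (3.55).
[cite: Balaban1985BackgroundPropagators, (3.55) p.401] [cite: Balaban1985Averaging, (43) p.24] -/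
noncomputable def leg (l : ℕ) (v : Fin d → ℕ) : 𝔸ˣ :=
  hol (avgIter L V l) ((L : ℤ) • qv L (l + 1) v) (treeWord (rv L l v))

/-- **THE RECURSIVE CONTOUR VARIABLE (3.55)** with base point `x_j`: `U(Γ^{(j)}_{x_j,x}) = Ū^{j−1}(Γ_{x_j,x_{j−1}})·…·U(Γ_{x₁,x})`
(top level first). [cite: Balaban1985BackgroundPropagators, (3.55) p.401] -/
noncomputable def chain : ℕ → (Fin d → ℕ) → 𝔸ˣ
  | 0, _ => 1
  | j + 1, v => leg L V j v * chain j v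

omit [NormOneClass 𝔸] in
/-- `chain 0 = 1`. [folklore] -/
@[simp] theorem chain_zero (v : Fin d → ℕ) : chain L V 0 v = 1 := rfl
omit [NormOneClass 𝔸] in
/-- `chain (j+1) = leg j · chain j`. [folklore] -/
theorem chain_succ (j : ℕ) (v : Fin d → ℕ) : chain L V (j + 1) v = leg L V j v * chain L V j v := rfl

omit [NormOneClass 𝔸] [NormedAlgebra ℂ 𝔸] [CompleteSpace 𝔸] in
/-- THE UNROLLED FINE POLYGON of the chain: the concatenation, top level first, of the leg tree contours scaled to the fine
lattice — a POSITIVE list of directions. [folklore] -/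
def fineList (L : ℕ) : ℕ → (Fin d → ℕ) → List (Fin d)
  | 0, _ => []
  | j + 1, v => scaleList (L ^ j) (treeList (rv L j v)) ++ fineList L j v

omit [NormOneClass 𝔸] [NormedAlgebra ℂ 𝔸] [CompleteSpace 𝔸] in
/-- The fine polygon runs from `L^j·x_j` to `v`: `disp (posWord (fineList L j v)) = v − L^j•x_j`. [folklore] -/
theorem disp_posWord_fineList (L : ℕ) (v : Fin d → ℕ) :
    ∀ j : ℕ, disp (posWord (fineList L j v)) = natVec v - ((L : ℤ) ^ j) • qv L j v
  | 0 => by simp [fineList]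
  | j + 1 => by
    rw [fineList, posWord_append, disp_append, disp_posWord_scaleList, disp_posWord_treeList _ (rv_nonneg L j v),
      disp_posWord_fineList L v j, rv, smul_sub, smul_smul, Nat.cast_pow, ← pow_succ]
    abel

/-- The chain is `{|u| ≤ 1, |u⁻¹| ≤ 1}`-valued when the levels below `j` are. [folklore] -/
theorem chain_mem : ∀ (j : ℕ), (∀ l < j, ∀ x κ, avgIter L V l x κ ∈ U1 𝔸) → ∀ v : Fin d → ℕ, chain L V j v ∈ U1 𝔸
  | 0, _, v => by rw [chain_zero]; exact (U1 𝔸).one_mem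
  | j + 1, hU, v => by
    rw [chain_succ]
    exact (U1 𝔸).mul_mem (hol_mem (hU j (Nat.lt_succ_self j)) _ _)
      (chain_mem j (fun l hl => hU l (Nat.lt_succ_of_lt hl)) v)

/-! ## §3 The chain against its fine polygon -/

/-- **`‖U(Γ^{(j)}_{x_j,x}) − U(fine polygon)‖ ≤ Σ_{l<j} |r_l|₁·E_l`**: if for every level `l < j` every bond variable of `Ū^l`
is within `E_l` of the fine transport along its straight segment of `L^l` steps (part 1's `level_defect_le`), then the
(3.55) chain differs from the fine transport along its unrolled polygon (from `L^j·x_j`) by at most `Σ_{l<j} |r_l|₁·E_l`.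
[cite: Balaban1985BackgroundPropagators, (3.55) p.401] -/
theorem norm_chain_sub_fine_le (hV : ∀ x κ, V x κ ∈ U1 𝔸) (E : ℕ → ℝ) (v : Fin d → ℕ) :
    ∀ (j : ℕ), (∀ l < j, ∀ x κ, avgIter L V l x κ ∈ U1 𝔸) →
      (∀ l < j, ∀ (z : Site d) (κ : Fin d),
        ‖((avgIter L V l z κ : 𝔸ˣ) : 𝔸) -
            ((hol V (((L ^ l : ℕ) : ℤ) • z) (seg κ ((L ^ l : ℕ) : ℤ)) : 𝔸ˣ) : 𝔸)‖ ≤ E l) →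
      ‖((chain L V j v : 𝔸ˣ) : 𝔸) -
          ((hol V (((L : ℤ) ^ j) • qv L j v) (posWord (fineList L j v)) : 𝔸ˣ) : 𝔸)‖ ≤
        ∑ l ∈ Finset.range j, (l1 (rv L l v) : ℝ) * E l
  | 0, _, _ => by simp [fineList]
  | j + 1, hU, hE => by
    have ih := norm_chain_sub_fine_le hV E v j (fun l hl => hU l (Nat.lt_succ_of_lt hl))
      (fun l hl => hE l (Nat.lt_succ_of_lt hl))
    -- the leg at level `j` against its scaled tree word
    have hleg := norm_hol_posWord_sub_scaled_le (avgIter L V j) V (hU j (Nat.lt_succ_self j)) hV (L ^ j)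
      (hE j (Nat.lt_succ_self j)) (treeList (rv L j v)) ((L : ℤ) • qv L (j + 1) v)
    rw [posWord_treeList _ (rv_nonneg L j v), length_treeList _ (rv_nonneg L j v), smul_smul, Nat.cast_pow,
      ← pow_succ] at hleg
    -- split the fine polygon after the top leg
    rw [chain_succ, fineList, posWord_append, hol_append, disp_posWord_scaleList,
      disp_posWord_treeList _ (rv_nonneg L j v), Nat.cast_pow,
      show ((L : ℤ) ^ (j + 1)) • qv L (j + 1) v + ((L : ℤ) ^ j) • rv L j v = ((L : ℤ) ^ j) • qv L j v by
        rw [rv, smul_sub, smul_smul, ← pow_succ]; abel,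
      Units.val_mul, Units.val_mul, Finset.sum_range_succ, add_comm (∑ l ∈ Finset.range j, (l1 (rv L l v) : ℝ) * E l)]
    refine (norm_mul_sub_mul_le_of_norm_le_one (chain_mem L V j (fun l hl => hU l (Nat.lt_succ_of_lt hl)) v).1
      (hol_mem hV _ _).1).trans (add_le_add ?_ ih)
    exact hleg

/-! ## §4 END: the mixed-loop defect of PRINT's transport against the straight tree transport -/

/-- **MIXED LOOP «tree contour (fine field) vs recursive averaged-leg contour (3.55)»**: for `v` in the `j`-block with base
point `0` (so `x_j = 0`), if every unit plaquette of `U` is within `α` of `1` and the levels below `j` obey the bond defects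
`E_l`, then `‖U(treeWord v)·U(Γ^{(j)}_{0,v})⁻¹ − 1‖ ≤ C(|v|₁, 2)·α + Σ_{l<j} |r_l|₁·E_l` — the first term by d4-p2's area law
for the monotone pair (tree word, unrolled polygon), the second by §3.  This is the `hdef`-type input (d4-p3
`coarse_coercive_cov₂`) for the two-transport E-I3 with PRINT's transport in the average.
[cite: Balaban1985BackgroundPropagators, (3.19) p.393, (3.55) p.401] -/
theorem norm_tree_mul_chain_inv_sub_one_le (hV : ∀ x κ, V x κ ∈ U1 𝔸) {α : ℝ} (hα : 0 ≤ α)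
    (h44 : ∀ (x : Site d) (κ μ : Fin d), ‖((hol V x (plaqWord κ μ) : 𝔸ˣ) : 𝔸) - 1‖ ≤ α)
    (E : ℕ → ℝ) (j : ℕ) (hU : ∀ l < j, ∀ x κ, avgIter L V l x κ ∈ U1 𝔸)
    (hE : ∀ l < j, ∀ (z : Site d) (κ : Fin d),
      ‖((avgIter L V l z κ : 𝔸ˣ) : 𝔸) -
          ((hol V (((L ^ l : ℕ) : ℤ) • z) (seg κ ((L ^ l : ℕ) : ℤ)) : 𝔸ˣ) : 𝔸)‖ ≤ E l)
    (v : Fin d → ℕ) (hv : ∀ i, v i < L ^ j) :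
    ‖((hol V 0 (treeWord (natVec v)) * (chain L V j v)⁻¹ : 𝔸ˣ) : 𝔸) - 1‖ ≤
      ((l1 (natVec v)).choose 2 : ℕ) * α + ∑ l ∈ Finset.range j, (l1 (rv L l v) : ℝ) * E l := by
  have hq : qv L j v = 0 := qv_eq_zero_of_lt L j v hv
  have hfine := norm_chain_sub_fine_le L V hV E v j hU hE
  rw [hq, smul_zero] at hfine
  set F : 𝔸ˣ := hol V 0 (posWord (fineList L j v)) with hF
  have hFm : F ∈ U1 𝔸 := hol_mem hV _ _
  have hCm : chain L V j v ∈ U1 𝔸 := chain_mem L V j hU v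
  -- the tree word and the fine polygon are positive words with the same displacement
  have hperm : (treeList (natVec v)).Perm (fineList L j v) :=
    perm_of_disp_eq (by rw [disp_posWord_treeList _ (natVec_nonneg v), disp_posWord_fineList, hq, smul_zero, sub_zero])
  have hP := norm_hol_posWord_perm_le hV hα h44 (treeList (natVec v)) (fineList L j v) hperm 0
  rw [length_treeList _ (natVec_nonneg v)] at hP
  rw [← posWord_treeList _ (natVec_nonneg v)]
  calc _ ≤ ‖((hol V 0 (posWord (treeList (natVec v))) * F⁻¹ : 𝔸ˣ) : 𝔸) - 1‖ +
          ‖((F * (chain L V j v)⁻¹ : 𝔸ˣ) : 𝔸) - 1‖ := norm_mul_inv_sub_one_triangle _ hFm hCm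
    _ ≤ ((l1 (natVec v)).choose 2 : ℕ) * α + ‖(F : 𝔸) - chain L V j v‖ :=
          add_le_add hP (norm_mul_inv_sub_one_le_norm_sub F hCm)
    _ ≤ _ := by rw [norm_sub_rev]; exact add_le_add le_rfl hfine

/-! ## §5 The level inputs from the fine plaquettes alone (b07's Proposition 2 BY NAME) -/

/-- **THE LEVEL INPUTS FROM `pdev U < α`**: for a configuration with values in an `AvgClosed` gauge group `G` (e.g. the unitary
group of a C⋆-algebra) on `ℤ^d`, `L ≥ 2`, plaquette deviation `pdev U < α`, and B7's own smallness at every level `m < j`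
(`C₀·αL^{2m} ≤ 1/3`, `2αL^{2m} ≤ c₂′`, plus `(2(d+1)L)²·2αL^{2m} ≤ ½` for the logarithm), b07's Prop. 2 gives: every `Ū^m`,
`m ≤ j`, is `G`-valued (hence in `{|u| ≤ 1, |u⁻¹| ≤ 1}`), and the one-step defects are `δ_m ≤ 4·(2(d+1)L)²·(2αL^{2m})`.
[cite: Balaban1985Averaging, Prop. 2 (52)–(54) p.26] -/
theorem level_inputs_of_prop2 (hL : 2 ≤ L) {G : Subgroup 𝔸ˣ} (hG : AvgClosed d L G) (hVG : ∀ x κ, V x κ ∈ G)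
    {α : ℝ} (hα : 0 < α) (h52 : pdev V < α) (j : ℕ)
    (hreg : ∀ m < j, C0 d * (α * ((L : ℝ) ^ m) ^ 2) ≤ 1 / 3 ∧ 2 * (α * ((L : ℝ) ^ m) ^ 2) ≤ c2' d L)
    (hlog : ∀ m < j, (2 * ((d : ℝ) + 1) * L) ^ 2 * (2 * (α * ((L : ℝ) ^ m) ^ 2)) ≤ 1 / 2) :
    (∀ m < j, ∀ x κ, avgIter L V m x κ ∈ U1 𝔸) ∧
      ∀ m < j, ∀ (z : Site d) (κ : Fin d),
        ‖((bavg L (avgIter L V m) ((L : ℤ) • z) κ : 𝔸ˣ) : 𝔸) -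
            ((hol (avgIter L V m) ((L : ℤ) • z) (seg κ (L : ℤ)) : 𝔸ˣ) : 𝔸)‖ ≤
          4 * ((2 * ((d : ℝ) + 1) * L) ^ 2 * (2 * (α * ((L : ℝ) ^ m) ^ 2))) := by
  have hL1 : 1 ≤ L := le_trans (by norm_num) hL
  have hLpos : (0 : ℝ) < L := by exact_mod_cast (lt_of_lt_of_le (by norm_num) hL : 0 < L)
  -- Prop. 2 at level `m`, with `α₀ := α·L^{2m}`
  have hP2 : ∀ m < j, pdev (avgIter L V m) < 2 * (α * ((L : ℝ) ^ m) ^ 2) ∧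
      ∀ j' ≤ m, ∀ x κ, avgIter L V j' x κ ∈ G := by
    intro m hm
    have hα₀ : 0 < α * ((L : ℝ) ^ m) ^ 2 := by positivity
    have h52' : pdev V < α * ((L : ℝ) ^ m) ^ 2 * ((((L : ℝ) ^ m)⁻¹) ^ 2) := by
      rwa [mul_assoc, ← mul_pow, mul_inv_cancel₀ (by positivity), one_pow, mul_one]
    have h := prop2_explicit L hL hG m V hVG hα₀ (hreg m hm).1 (hreg m hm).2 h52'
    exact ⟨(prop2_explicit_lt_two L hL hG m V hVG hα₀ (hreg m hm).1 (hreg m hm).2 h52'), h.2⟩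
  have hU : ∀ m < j, ∀ x κ, avgIter L V m x κ ∈ U1 𝔸 := fun m hm x κ =>
    hG.le_U1 ((hP2 m hm).2 m le_rfl x κ)
  refine ⟨hU, fun m hm z κ => ?_⟩
  have hdev : ∀ (x : Site d) (κ' μ : Fin d), κ' ≠ μ →
      ‖((hol (avgIter L V m) x (plaqWord κ' μ) : 𝔸ˣ) : 𝔸) - 1‖ ≤ 2 * (α * ((L : ℝ) ^ m) ^ 2) :=
    fun x κ' μ _ => (le_pdev (hU m hm) x κ' μ).trans (hP2 m hm).1.le
  exact norm_bavg_sub_hol_seg_le_linear L hL1 (avgIter L V m) (hU m hm) (by positivity) (hlog m hm) hdev _ κ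

/-- **PRINT'S TRANSPORT AGAINST THE TREE TRANSPORT FROM THE FINE PLAQUETTES ALONE.**  Under `pdev U < α` and B7's smallness at
the levels `m < j`: for every `v` in the `j`-block with base point `0`,
`‖U(treeWord v)·U(Γ^{(j)}_{0,v})⁻¹ − 1‖ ≤ C(|v|₁, 2)·α + Σ_{l<j} |r_l|₁·E_l` with `E_l = levelE L δ l = Σ_{m<l} L^{l−1−m}δ_m`,
`δ_m = 4(2(d+1)L)²·2αL^{2m}` — every quantity an explicit function of `d, L, α, j` (j-UNIFORM exactly in print's regime
`αL^{2j} = O(Mα₀)`: `δ_m ≍ αL^{2m+2}`, `E_l ≍ αL^{2l+1}`, `Σ_{l<j} d(L−1)E_l ≍ d³·αL^{2j}`).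
[cite: Balaban1985BackgroundPropagators, (3.19) p.393, (3.55) p.401] [cite: Balaban1985Averaging, Prop. 2 (54) p.26] -/
theorem print_transport_defect (hL : 2 ≤ L) {G : Subgroup 𝔸ˣ} (hG : AvgClosed d L G) (hVG : ∀ x κ, V x κ ∈ G)
    {α : ℝ} (hα : 0 < α) (h52 : pdev V < α) (j : ℕ)
    (hreg : ∀ m < j, C0 d * (α * ((L : ℝ) ^ m) ^ 2) ≤ 1 / 3 ∧ 2 * (α * ((L : ℝ) ^ m) ^ 2) ≤ c2' d L)
    (hlog : ∀ m < j, (2 * ((d : ℝ) + 1) * L) ^ 2 * (2 * (α * ((L : ℝ) ^ m) ^ 2)) ≤ 1 / 2)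
    (v : Fin d → ℕ) (hv : ∀ i, v i < L ^ j) :
    ‖((hol V 0 (treeWord (natVec v)) * (chain L V j v)⁻¹ : 𝔸ˣ) : 𝔸) - 1‖ ≤
      ((l1 (natVec v)).choose 2 : ℕ) * α +
        ∑ l ∈ Finset.range j, (l1 (rv L l v) : ℝ) *
          levelE L (fun m => 4 * ((2 * ((d : ℝ) + 1) * L) ^ 2 * (2 * (α * ((L : ℝ) ^ m) ^ 2)))) l := by
  obtain ⟨hU, hδ⟩ := level_inputs_of_prop2 L V hL hG hVG hα h52 j hreg hlog
  have hV : ∀ x κ, V x κ ∈ U1 𝔸 := fun x κ => hG.le_U1 (hVG x κ)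
  have h44 : ∀ (x : Site d) (κ μ : Fin d), ‖((hol V x (plaqWord κ μ) : 𝔸ˣ) : 𝔸) - 1‖ ≤ α := by
    intro x κ μ
    rcases eq_or_ne κ μ with rfl | hκμ
    · rw [hol_plaqWord_self]; simp [hα.le]
    · exact (le_pdev hV x κ μ).trans h52.le
  refine norm_tree_mul_chain_inv_sub_one_le L V hV hα.le h44 _ j hU (fun l hl z κ => ?_) v hv
  exact level_defect_le L V hV _ l (fun m hm => hU m (lt_of_le_of_lt hm hl)) (fun m hm => hδ m (hm.trans hl)) z κ

/-! ### The closed form: j-uniformity in print's regime `αL^{2j} = O(Mα₀)` -/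

omit [NormOneClass 𝔸] [NormedAlgebra ℂ 𝔸] [CompleteSpace 𝔸] in
/-- The level sums for quadratically growing defects, multiplied form: `L²·E_l ≤ 2K·L^{2l}` when `δ_m = K·L^{2m}`, `L ≥ 2`
(`E_{l+1} = K L^{2l} + L·E_l` and `2L ≤ L²`). [folklore] -/
theorem levelE_sq_le_mul (hL : 2 ≤ L) {K : ℝ} (hK : 0 ≤ K) :
    ∀ l : ℕ, (L : ℝ) ^ 2 * levelE L (fun m => K * ((L : ℝ) ^ m) ^ 2) l ≤ 2 * K * ((L : ℝ) ^ l) ^ 2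
  | 0 => by rw [levelE_zero, mul_zero]; positivity
  | l + 1 => by
    have hLr : (2 : ℝ) ≤ L := by exact_mod_cast hL
    have hL0 : (0 : ℝ) ≤ L := by linarith
    have ih := levelE_sq_le_mul hL hK l
    have hx : 0 ≤ ((L : ℝ) ^ l) ^ 2 := by positivity
    rw [levelE_succ]
    have hpow : ((L : ℝ) ^ (l + 1)) ^ 2 = (L : ℝ) ^ 2 * ((L : ℝ) ^ l) ^ 2 := by ring
    have h1 : (L : ℝ) ^ 2 * (K * ((L : ℝ) ^ l) ^ 2 + L * levelE L (fun m => K * ((L : ℝ) ^ m) ^ 2) l) =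
        K * (L : ℝ) ^ 2 * ((L : ℝ) ^ l) ^ 2 + L * ((L : ℝ) ^ 2 * levelE L (fun m => K * ((L : ℝ) ^ m) ^ 2) l) := by
      ring
    rw [hpow, h1]
    have h2 : (L : ℝ) * ((L : ℝ) ^ 2 * levelE L (fun m => K * ((L : ℝ) ^ m) ^ 2) l) ≤ L * (2 * K * ((L : ℝ) ^ l) ^ 2) :=
      mul_le_mul_of_nonneg_left ih hL0
    have h3 : 0 ≤ ((L : ℝ) - 2) * (K * ((L : ℝ) ^ l) ^ 2) * L :=
      mul_nonneg (mul_nonneg (by linarith) (mul_nonneg hK hx)) hL0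
    nlinarith

omit [NormOneClass 𝔸] [NormedAlgebra ℂ 𝔸] [CompleteSpace 𝔸] in
/-- … divided form: `E_l ≤ (2K∕L²)·L^{2l}`. [folklore] -/
theorem levelE_sq_le (hL : 2 ≤ L) {K : ℝ} (hK : 0 ≤ K) (l : ℕ) :
    levelE L (fun m => K * ((L : ℝ) ^ m) ^ 2) l ≤ 2 * K / (L : ℝ) ^ 2 * ((L : ℝ) ^ l) ^ 2 := by
  have hLr : (2 : ℝ) ≤ L := by exact_mod_cast hL
  have hL2 : (0 : ℝ) < (L : ℝ) ^ 2 := by positivity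
  have h := levelE_sq_le_mul L hL hK l
  rw [div_mul_eq_mul_div, le_div_iff₀ hL2]
  linarith

omit [NormOneClass 𝔸] [NormedAlgebra ℂ 𝔸] [CompleteSpace 𝔸] in
/-- The geometric sum `Σ_{l<j} L^{2l} ≤ L^{2j}∕(L² − 1)` for `L ≥ 2`. [folklore] -/
theorem sum_sq_pow_le (hL : 2 ≤ L) :
    ∀ j : ℕ, ∑ l ∈ Finset.range j, ((L : ℝ) ^ l) ^ 2 ≤ ((L : ℝ) ^ j) ^ 2 / ((L : ℝ) ^ 2 - 1)
  | 0 => by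
    have hLr : (2 : ℝ) ≤ L := by exact_mod_cast hL
    rw [Finset.sum_range_zero]
    exact div_nonneg (by positivity) (by nlinarith)
  | j + 1 => by
    have hLr : (2 : ℝ) ≤ L := by exact_mod_cast hL
    have hden : (0 : ℝ) < (L : ℝ) ^ 2 - 1 := by nlinarith
    rw [Finset.sum_range_succ]
    refine (add_le_add (sum_sq_pow_le hL j) le_rfl).trans (le_of_eq ?_)
    rw [div_add' _ _ _ hden.ne', pow_succ]
    congr 1; ring

/-- **THE CLOSED FORM** of `print_transport_defect`: under the same hypotheses,
`‖U(treeWord v)·U(Γ^{(j)}_{0,v})⁻¹ − 1‖ ≤ C(|v|₁, 2)·α + 64·d(d+1)²·(αL^{2j})∕(L+1)` — with `n = L^j` the block side and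
`αn² = O(1)Mα₀(1 + O(1)Mα₀)` from (3.35) (b09 `B9Eq335Plaquette.b7_52_of_b9_335`), the second term is `O(d³·Mα₀)`, UNIFORM IN `j`;
the first is `≤ ½d²(n−1)²α`, also `O(d²Mα₀)`. [cite: Balaban1985BackgroundPropagators, (3.35) p.396, (3.55) p.401] -/
theorem print_transport_defect_closed (hL : 2 ≤ L) {G : Subgroup 𝔸ˣ} (hG : AvgClosed d L G) (hVG : ∀ x κ, V x κ ∈ G)
    {α : ℝ} (hα : 0 < α) (h52 : pdev V < α) (j : ℕ)
    (hreg : ∀ m < j, C0 d * (α * ((L : ℝ) ^ m) ^ 2) ≤ 1 / 3 ∧ 2 * (α * ((L : ℝ) ^ m) ^ 2) ≤ c2' d L)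
    (hlog : ∀ m < j, (2 * ((d : ℝ) + 1) * L) ^ 2 * (2 * (α * ((L : ℝ) ^ m) ^ 2)) ≤ 1 / 2)
    (v : Fin d → ℕ) (hv : ∀ i, v i < L ^ j) :
    ‖((hol V 0 (treeWord (natVec v)) * (chain L V j v)⁻¹ : 𝔸ˣ) : 𝔸) - 1‖ ≤
      ((l1 (natVec v)).choose 2 : ℕ) * α +
        64 * d * ((d : ℝ) + 1) ^ 2 * (α * ((L : ℝ) ^ j) ^ 2) / ((L : ℝ) + 1) := by
  have hLr : (2 : ℝ) ≤ L := by exact_mod_cast hL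
  have hL0 : (0 : ℝ) < L := by linarith
  have hLpos : 0 < L := lt_of_lt_of_le (by norm_num) hL
  refine (print_transport_defect L V hL hG hVG hα h52 j hreg hlog v hv).trans (add_le_add le_rfl ?_)
  -- the defects are `K·L^{2m}` with `K = 32(d+1)²L²α`
  set K : ℝ := 32 * ((d : ℝ) + 1) ^ 2 * (L : ℝ) ^ 2 * α with hK
  have hK0 : 0 ≤ K := by positivity
  have hδ : (fun m : ℕ => 4 * ((2 * ((d : ℝ) + 1) * L) ^ 2 * (2 * (α * ((L : ℝ) ^ m) ^ 2)))) =
      fun m : ℕ => K * ((L : ℝ) ^ m) ^ 2 := by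
    funext m; rw [hK]; ring
  rw [hδ]
  -- each leg has `|r_l|₁ ≤ d(L−1)` bonds
  have hr : ∀ l, (l1 (rv L l v) : ℝ) ≤ d * ((L : ℝ) - 1) := fun l => by
    have h := l1_rv_le L l hLpos v
    have hL1 : 1 ≤ L := le_of_lt hL
    calc (l1 (rv L l v) : ℝ) ≤ ((d * (L - 1) : ℕ) : ℝ) := by exact_mod_cast h
      _ = d * ((L : ℝ) - 1) := by push_cast [Nat.cast_sub hL1]; ring
  calc ∑ l ∈ Finset.range j, (l1 (rv L l v) : ℝ) * levelE L (fun m => K * ((L : ℝ) ^ m) ^ 2) l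
      ≤ ∑ l ∈ Finset.range j, (d * ((L : ℝ) - 1)) * (2 * K / (L : ℝ) ^ 2 * ((L : ℝ) ^ l) ^ 2) :=
        Finset.sum_le_sum fun l _ => mul_le_mul (hr l) (levelE_sq_le L hL hK0 l)
          (levelE_nonneg L (fun m => by positivity) l) (by nlinarith)
    _ = (d * ((L : ℝ) - 1)) * (2 * K / (L : ℝ) ^ 2) * ∑ l ∈ Finset.range j, ((L : ℝ) ^ l) ^ 2 := by
        rw [Finset.mul_sum]; refine Finset.sum_congr rfl fun l _ => ?_; ring
    _ ≤ (d * ((L : ℝ) - 1)) * (2 * K / (L : ℝ) ^ 2) * (((L : ℝ) ^ j) ^ 2 / ((L : ℝ) ^ 2 - 1)) := by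
        apply mul_le_mul_of_nonneg_left (sum_sq_pow_le L hL j)
        have : 0 ≤ (L : ℝ) - 1 := by linarith
        positivity
    _ = 64 * d * ((d : ℝ) + 1) ^ 2 * (α * ((L : ℝ) ^ j) ^ 2) / ((L : ℝ) + 1) := by
        have h1 : (L : ℝ) ^ 2 - 1 = ((L : ℝ) - 1) * ((L : ℝ) + 1) := by ring
        have h2 : (L : ℝ) - 1 ≠ 0 := by linarith
        have h3 : (L : ℝ) + 1 ≠ 0 := by linarith
        rw [h1, hK]
        field_simp
        ring

end Chain

/-! ## §6 Non-vacuity -/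

section NonVacuity

open scoped Matrix.Norms.L2Operator

/-- For the flat configuration on `ℤ²` the chain of depth `0` is `1` and the END at `j = 0` (the only in-block site is
`v = 0`) reads `‖1·1⁻¹ − 1‖ ≤ 0·α + 0`. [folklore] -/
example (α : ℝ) (hα : 0 ≤ α) :
    ‖((hol (fun (_ : Site 2) (_ : Fin 2) => (1 : (Matrix (Fin 2) (Fin 2) ℂ)ˣ)) 0 (treeWord (natVec (fun _ : Fin 2 => 0))) *
          (chain 2 (fun (_ : Site 2) (_ : Fin 2) => (1 : (Matrix (Fin 2) (Fin 2) ℂ)ˣ)) 0 (fun _ : Fin 2 => 0))⁻¹ :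
            (Matrix (Fin 2) (Fin 2) ℂ)ˣ) : Matrix (Fin 2) (Fin 2) ℂ) - 1‖ ≤
      ((l1 (natVec (fun _ : Fin 2 => (0 : ℕ)))).choose 2 : ℕ) * α +
        ∑ l ∈ Finset.range 0, (l1 (rv 2 l (fun _ : Fin 2 => (0 : ℕ))) : ℝ) * 0 :=
  norm_tree_mul_chain_inv_sub_one_le 2 _ (fun _ _ => (U1 _).one_mem) hα
    (fun x κ μ => by
      have : hol (fun (_ : Site 2) (_ : Fin 2) => (1 : (Matrix (Fin 2) (Fin 2) ℂ)ˣ)) x (plaqWord κ μ) = 1 := by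
        simp [plaqWord, stepHol_true, stepHol_false]
      rw [this]; simpa using hα)
    (fun _ => 0) 0 (fun l hl => absurd hl (Nat.not_lt_zero l)) (fun l hl => absurd hl (Nat.not_lt_zero l)) _
    (fun i => by simp)

end NonVacuity

end Summit.QuantumFields.BalabanUV.Beta.AveragedContourChain
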